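import Summits.QuantumFields.YangMills.Theorems.UnitScaleTiltFluctuationComparisonRegPrGlobalSlackKernelEndToEnd
import Summits.QuantumFields.YangMills.Theorems.UnitScaleTiltFluctuationComparisonRegPrGlobalSlackCanonicalPolymersTermSize
import Summits.QuantumFields.YangMills.Theorems.UnitScaleTiltFluctuationComparisonRegPrGlobalSlackCanonicalPolymersMatched
import HarnessLib

/-!
# `UnitScaleTiltFluctuationComparisonRegPrGlobalSlackCanonicalEndToEnd` — STUB 3⁗ FROM THE SIX CHART ROWS AT THE CANONICAL POLYMERISATION, BY NAME
# (crux `FluctuationComparisonRegPrL`, stmt-QuantumFields-19935, STUB 3⁗ `stub_globalTwoRunSlackFam`; width-lever lane A, capstone)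

Seat ym-ust-19935-slack g0 (prover).  `GlobalSlackKernelMatching.K1aLine L 𝔠 a₀ a₁ a` (p532839) lists ELEVEN rows at `dataOfV3 p π`: five PRODUCER rows
(`PintDecompTrivT`, `LocCover`, `LocBlockVolume`, `LocMatched`, `TermSizeTrivT`) and six CHART rows.  For the CANONICAL polymerisation `π := canonPolymer p`,
`PT := canonPT p` of the family (`…CanonicalPolymers`, p533541) the five producer rows are THEOREMS — `pintDecompTrivT_canon` (p533541), `locCover_canon`
(`…Cover`), `locBlockVolume_canon` (`…Volume`, p534516), `locMatched_canon` (`…Matched`), `termSizeTrivT_canon` (`…TermSize`) — given the located letters of the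
record: `L ≤ M₁` (volume), `κ₀(32,6) ≤ κ ≤ 𝔠.κ` (cover / new-term decay) and the two coupling windows of the sizes file (`cB·r(g_k)g_kp(g_k) ≤ ρ/4`,
`8L²B₃Z′·g_kp(g_k) ≤ ½`).  Hence:

* §1 `newConstL`/`oldConstL` (the size constants as functions of `L` and the record, `= newConst`/`oldConst` by `rfl`), nonnegativity;
* §2 **`K1aChartLine L 𝔠 a₀ a₁ a`** — the K1a line with ONLY the six chart rows (at `dataOfV3 p (canonPolymer p)`, term function `canonPT p`), the window
  `(C_s + C_B)θ(n) ≤ 1`, the two coupling windows, and the letters `0 < κ ≤ 𝔠.κ`, `κ₀(32,6) ≤ κ`, `L ≤ M₁`;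
  **`k1aLine_of_chartLine : K1aChartLine L 𝔠 a₀ a₁ a → K1aLine L 𝔠 a₀ a₁ a`** (`C_T := max newConstL (oldConstL·L⁴)`, `C' := max 1 K₀(32,6)`);
* §3 **`globalTwoRunSlackFam_of_k1aChartLine`**: `(∀ L …, ∃ a, 0 < a ∧ a < 1 ∧ K1aChartLine L 𝔠 a₀ a₁ a) →` THE REGISTERED TEXT OF `stub_globalTwoRunSlackFam`
  VERBATIM (`= globalTwoRunSlackFam_of_k1aLine ∘ k1aLine_of_chartLine`);
* §4 the three coupling windows FOLLOW from `γ` small (`T3Thresholds.θBal_le_of_le_gamma`; `rFun_mul_mul_pFun`: the collar polylogarithm joins the threshold's):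
  `gammaθ`, `window_sum_le_one`, `window_jet`, `window_oldSlice`, `gammaW`; **`K1aChartRows`** (the six chart rows + letters, NO windows), **`k1aChartLine_of_chartRows`**,
  **`globalTwoRunSlackFam_of_k1aChartRows`**: ⟨REGISTERED 3⁗ TEXT⟩ from the six chart rows alone.
So the registered 3⁗ is, BY NAME, the six chart rows of the K1a line at the canonical polymerisation (K1a `FlatKernelCauchyΦ`, `TaylorSplitΦ`, `KernelSizeΦ`,
`RemainderSmallΦ`, `CfgSizeΦ`, `CfgCauchyΦ (ℓ ≡ 1)`), two of which (`KernelSizeΦ`, the Taylor part of `RemainderSmallΦ`) are themselves theorems under G3D-01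
(p531504).  Every `def` is a hypothesis schema; nothing of [Balaban1985UV3]/[King1986] is asserted.

References: C. King, CMP 102 (1986) 649–677 [King1986] (Thm 3.4 (3.9) p.656, Prop. 3.6 p.662); T. Bałaban, CMP 102 (1985) 255–275 [Balaban1985UV3] ((24)–(25) p.262,
(28)–(30) p.263, (33)–(34) p.264, (43)–(46) pp.266–267, (57)–(61) pp.270–271); CMP 109 (1987) 249–301 [Balaban1987RG1] ((0.1) p.251, (0.26) p.257, (0.30) p.258).
-/

set_option autoImplicit false

noncomputable section

namespace Summit.QuantumFields.YangMills.Theorems.GlobalSlackCanonicalPolymers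

open scoped BigOperators
open Literature.MathematicalPhysics.QuantumFieldTheory.Balaban1983to89
open Literature.MathematicalPhysics.QuantumFieldTheory.Balaban1983to89.T3ContinuumYM3Torus
open Literature.MathematicalPhysics.QuantumFieldTheory.Balaban1983to89.T3UnitScaleTilt (θBal)
open Literature.MathematicalPhysics.QuantumFieldTheory.Balaban1983to89.T3AlphaInputsAC
open Literature.MathematicalPhysics.QuantumFieldTheory.Balaban1983to89.T3AlphaInputsACTwoRun
open Literature.MathematicalPhysics.QuantumFieldTheory.Balaban1983to89.T3AlphaInputsACTwoRunLevel
open Literature.MathematicalPhysics.QuantumFieldTheory.Balaban1983to89.B12TreeDecay (kappa₀ K₀ K₀_pos)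
open Literature.MathematicalPhysics.QuantumFieldTheory.Balaban1985CMP102
open Literature.MathematicalPhysics.QuantumFieldTheory.Balaban1985CMP102.Setting
open Summit.QuantumFields.Balaban3D.Carriers
open Summit.QuantumFields.Balaban3D.Proofs.Primitives
open Summit.QuantumFields.Balaban3D.Proofs.GroupModelLieC (lieC)
open Summit.QuantumFields.Balaban3D.Proofs.NewbornJet (tlConst tlConst_nonneg)
open Summit.QuantumFields.YangMills.Theorems
open Summit.QuantumFields.YangMills.Theorems.GlobalSlack (GlobalSupRateTSlack)
open Summit.QuantumFields.YangMills.Theorems.GlobalSlackKernelMatching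

/-! ## §1 The size constants as functions of `L` and the record -/

/-- The new-term size constant of `…CanonicalPolymersSizes` as a function of `L` and the record (chosen before the family). [cite: Balaban1985UV3, (25) p.262, (34) p.264, (61) p.271] -/
def newConstL (L : ℕ) (𝔠 : AlphaConsts L (suGroupModel 2).N) : ℝ :=
  20 * 𝔠.C25 * 𝔠.cB ^ 2 / 𝔠.ρ ^ 2 * tlConst (2 * 𝔠.r₀) 1 +
    𝔠.Cfar * 𝔠.C25 * 𝔠.b₀ ^ 5 * tlConst (7 * 𝔠.r₀ + 5 * 𝔠.p₀) 6 + 𝔠.C45 * 𝔠.C63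

/-- The old-term size constant of `…CanonicalPolymersSizes` as a function of `L` and the record. [cite: Balaban1985UV3, (44)-(46) p.267] -/
def oldConstL (L : ℕ) (𝔠 : AlphaConsts L (suGroupModel 2).N) : ℝ := 2 * 𝔠.C44 * (8 * (L : ℝ) ^ 2 * 𝔠.B₃ * 𝔠.Zfull) ^ 2

/-- `newConst 𝔠 = newConstL F.L 𝔠` (definitional). [folklore] -/
theorem newConst_eq_newConstL {F : T3Family} (𝔠 : AlphaConsts F.L (suGroupModel 2).N) : newConst 𝔠 = newConstL F.L 𝔠 := rfl

/-- `oldConst 𝔠 = oldConstL F.L 𝔠` (definitional). [folklore] -/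
theorem oldConst_eq_oldConstL {F : T3Family} (𝔠 : AlphaConsts F.L (suGroupModel 2).N) : oldConst 𝔠 = oldConstL F.L 𝔠 := rfl

/-- `0 ≤ newConstL`. [folklore] -/
theorem newConstL_nonneg (L : ℕ) (𝔠 : AlphaConsts L (suGroupModel 2).N) : 0 ≤ newConstL L 𝔠 := by
  have h1 := 𝔠.C25_nonneg; have h2 := 𝔠.cB_nonneg; have h3 := 𝔠.Cfar_nonneg; have h4 := 𝔠.C45_nonneg; have h5 := 𝔠.C63_nonneg
  have h6 := 𝔠.b₀_pos.le; have hr := 𝔠.one_le_r₀; have hp := 𝔠.p₀_pos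
  have t1 : 0 ≤ tlConst (2 * 𝔠.r₀) 1 := tlConst_nonneg (by linarith) one_pos
  have t2 : 0 ≤ tlConst (7 * 𝔠.r₀ + 5 * 𝔠.p₀) 6 := tlConst_nonneg (by linarith) (by norm_num)
  unfold newConstL
  positivity

/-! ## §2 The K1a chart line at the canonical polymerisation -/

/-- **THE K1a CHART LINE AT THE CANONICAL POLYMERISATION** — `K1aLine` with the five producer rows REMOVED (they are theorems for `canonPolymer p`/`canonPT p`) and
the located letters of the record that those theorems read ADDED: a decay rate `0 < κ ≤ 𝔠.κ` with `κ₀(32,6) ≤ κ`, `L ≤ M₁`, and — inside, for every family /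
coupling / inhabited v3 package — the window `(C_s + C_B)θ(n) ≤ 1`, the two coupling windows `cB·r(g_k)g_kp(g_k) ≤ ρ/4`, `8L²B₃Z′·g_kp(g_k) ≤ ½` along both
runs' steps, a coherent family `p` with the given [7]-constants, ONE chart family over `↥(lieC (suGroupModel 2))` with configurations / vacuum constants / rests,
and the SIX CHART ROWS at `dataOfV3 p (canonPolymer p)` with term function `canonPT p`: `TaylorSplitΦ`, K1a `FlatKernelCauchyΦ`, `KernelSizeΦ`, `RemainderSmallΦ`,
`CfgSizeΦ`, `CfgCauchyΦ (ℓ ≡ 1)`.  Hypothesis schema; never asserted. [cite: Balaban1985UV3, (25) p.262, (28)-(30) p.263, (33)-(34) p.264, (43)-(46) pp.266-267; King1986, Thm 3.4 (3.9) p.656] -/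
def K1aChartLine (L : ℕ) (𝔠 : AlphaConsts L (suGroupModel 2).N) (a₀ a₁ a : ℝ) : Prop :=
  ∃ (κ C C_E C_R C_s C_B γB : ℝ), 0 < κ ∧ κ ≤ 𝔠.κ ∧ kappa₀ (4 * 2 ^ 3) (2 * 3) ≤ κ ∧ 0 ≤ C ∧ 0 ≤ C_E ∧ 0 ≤ C_R ∧ 0 ≤ C_s ∧ 0 ≤ C_B ∧ 0 < γB ∧
    L ≤ 𝔠.M₁ ∧
    ∀ (F : T3Family) (γ : ℝ) (hF : F.L = L) (hγ : 0 < γ), γ ≤ γB → ∀ (hγ1 : γ ≤ (min (hF ▸ 𝔠).gamma0 1) ^ 2),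
      AlphaInputsT3AC.OfV3At F (hF ▸ 𝔠) a₀ a₁ →
        (∀ n, (C_s + C_B) * θBal F.L γ (hF ▸ 𝔠).b₀ (hF ▸ 𝔠).p₀ n ≤ 1) ∧
        (∀ K k, k + 1 ≤ K → (hF ▸ 𝔠).cB * (B10.rFun (hF ▸ 𝔠).r₀ ((SK F (hF ▸ 𝔠) γ hγ hγ1 K).gk k) * (SK F (hF ▸ 𝔠) γ hγ hγ1 K).gk k *
            B10.pFun (hF ▸ 𝔠).b₀ (hF ▸ 𝔠).p₀ ((SK F (hF ▸ 𝔠) γ hγ hγ1 K).gk k)) ≤ (hF ▸ 𝔠).ρ / 4) ∧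
        (∀ K k, k + 1 ≤ K → 8 * (F.L : ℝ) ^ 2 * (hF ▸ 𝔠).B₃ * (hF ▸ 𝔠).Zfull *
            ((SK F (hF ▸ 𝔠) γ hγ hγ1 K).gk k * B10.pFun (hF ▸ 𝔠).b₀ (hF ▸ 𝔠).p₀ ((SK F (hF ▸ 𝔠) γ hγ hγ1 K).gk k)) ≤ 1 / 2) ∧
        ∃ (p : ∀ K, AlphaInputsT3AC.PkgAtV3 F (hF ▸ 𝔠) γ hγ hγ1 K), (∀ K, (p K).a₀ = a₀ ∧ (p K).a₁ = a₁) ∧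
          ∃ (Φ : ChartFam ↥(lieC (suGroupModel 2)) F) (e : VacFam F) (B : CfgFam ↥(lieC (suGroupModel 2)) F) (R : RemFam F),
            TaylorSplitΦ (canonPT p) Φ e B R ∧ FlatKernelCauchyΦ (AlphaInputsT3AC.dataOfV3 p (canonPolymer p)) Φ κ a C ∧
            KernelSizeΦ (AlphaInputsT3AC.dataOfV3 p (canonPolymer p)) Φ κ C_E ∧
            RemainderSmallΦ (AlphaInputsT3AC.dataOfV3 p (canonPolymer p)) R (hF ▸ 𝔠).b₀ (hF ▸ 𝔠).p₀ κ C_R ∧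
            CfgSizeΦ (AlphaInputsT3AC.dataOfV3 p (canonPolymer p)) B (hF ▸ 𝔠).b₀ (hF ▸ 𝔠).p₀ C_s ∧
            CfgCauchyΦ (AlphaInputsT3AC.dataOfV3 p (canonPolymer p)) B (hF ▸ 𝔠).b₀ (hF ▸ 𝔠).p₀ a C_B fun _ => 1

/-- **THE CHART LINE GIVES THE K1a LINE**: the five producer rows of `K1aLine` are supplied by `pintDecompTrivT_canon`, `locCover_canon` (`C' := max 1 K₀(32,6)`),
`locBlockVolume_canon`, `locMatched_canon`, `termSizeTrivT_canon` (`C_T := max newConstL (oldConstL·L⁴)`) for `π := canonPolymer p`, `PT := canonPT p`.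
[cite: Balaban1985UV3, (24)-(25) p.262, (43)-(46) pp.266-267, (59) p.270; Balaban1987RG1, (0.1) p.251, (0.30) p.258] -/
theorem k1aLine_of_chartLine {L : ℕ} {𝔠 : AlphaConsts L (suGroupModel 2).N} {a₀ a₁ a : ℝ} (h : K1aChartLine L 𝔠 a₀ a₁ a) : K1aLine L 𝔠 a₀ a₁ a := by
  obtain ⟨κ, C, C_E, C_R, C_s, C_B, γB, hκ0, hκle, hκ₀, hC, hCE, hCR, hCs, hCB, hγB, hM, hall⟩ := h
  refine ⟨κ, C, C_E, C_R, C_s, C_B, max (newConstL L 𝔠) (oldConstL L 𝔠 * (L : ℝ) ^ 4), max 1 (K₀ (4 * 2 ^ 3) (2 * 3)), γB,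
    hC, hCE, hCR, hCs, hCB, le_max_of_le_left (newConstL_nonneg L 𝔠), hγB, fun F γ hF hγ hγle hγ1 hOf => ?_⟩
  subst hF
  obtain ⟨hwin, hw1, hw2, p, hp, Φ, e, B, R, hT, hK, hE, hR, hS, hBC⟩ := hall F γ rfl hγ hγle hγ1 hOf
  exact ⟨hwin, p, hp, canonPolymer p, canonPT p, Φ, e, B, R, pintDecompTrivT_canon p, locCover_canon p hκ0.le hκ₀, locBlockVolume_canon p hM,
    locMatched_canon p, termSizeTrivT_canon p hM hκ0 hκle hw1 hw2, hT, hK, hE, hR, hS, hBC⟩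

/-! ## §3 The registered stub from the chart line -/

/-- **THE REGISTERED STUB 3⁗ FROM THE SIX CHART ROWS AT THE CANONICAL POLYMERISATION, BY NAME**: if for every odd `L ≥ 7`, every constants record and
[7]-constants there is a rate exponent `0 < a < 1` with `K1aChartLine L 𝔠 a₀ a₁ a`, then the text of `stub_globalTwoRunSlackFam` (skeleton v5j‴
`Cruxes/FluctuationComparisonRegPrL/Lines/birth_v5j3.lean`) holds VERBATIM (`globalTwoRunSlackFam_of_k1aLine ∘ k1aLine_of_chartLine`).
[cite: King1986, Thm 3.4 (3.9) p.656, Prop. 3.6 p.662; Balaban1985UV3, (43)-(46) pp.266-267, (57) p.270] -/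
theorem globalTwoRunSlackFam_of_k1aChartLine
    (h : ∀ (L : ℕ), Odd L → 7 ≤ L → ∀ (𝔠 : AlphaConsts L (suGroupModel 2).N) (a₀ a₁ : ℝ), 0 < a₀ → 0 < a₁ → 𝔠.B₃ * a₁ ≤ a₀ →
      ∃ a : ℝ, 0 < a ∧ a < 1 ∧ K1aChartLine L 𝔠 a₀ a₁ a) :
    ∀ (L : ℕ), Odd L → 7 ≤ L → ∀ (𝔠 : Summit.QuantumFields.Balaban3D.Proofs.Primitives.AlphaConsts L (Summit.QuantumFields.Balaban3D.Carriers.suGroupModel 2).N)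
      (a₀ a₁ : ℝ), 0 < a₀ → 0 < a₁ → 𝔠.B₃ * a₁ ≤ a₀ →
      ∃ a : ℝ, 0 < a ∧ ∃ γB : ℝ, 0 < γB ∧ ∀ (F : T3Family) (γ : ℝ) (hF : F.L = L) (hγ : 0 < γ), γ ≤ γB →
        ∀ (hγ1 : γ ≤ (min (hF ▸ 𝔠).gamma0 1) ^ 2),
          Summit.QuantumFields.YangMills.Theorems.AlphaInputsT3AC.OfV3At F (hF ▸ 𝔠) a₀ a₁ →
          ∃ (p : ∀ K, Summit.QuantumFields.YangMills.Theorems.AlphaInputsT3AC.PkgAtV3 F (hF ▸ 𝔠) γ hγ hγ1 K),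
            (∀ K, (p K).a₀ = a₀ ∧ (p K).a₁ = a₁) ∧
            ∃ (π : Summit.QuantumFields.YangMills.Theorems.AlphaInputsT3AC.PolymerT3 F) (σ : ℕ) (C : ℝ), 7 ≤ σ ∧ 0 ≤ C ∧
              Summit.QuantumFields.YangMills.Theorems.GlobalSlack.GlobalSupRateTSlack (Summit.QuantumFields.YangMills.Theorems.AlphaInputsT3AC.dataOfV3 p π) (hF ▸ 𝔠).b₀ (hF ▸ 𝔠).p₀ a σ C :=
  globalTwoRunSlackFam_of_k1aLine fun L hLo h7 𝔠 a₀ a₁ ha0 ha1 hw => by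
    obtain ⟨a, ha, ha1', hc⟩ := h L hLo h7 𝔠 a₀ a₁ ha0 ha1 hw
    exact ⟨a, ha, ha1', k1aLine_of_chartLine hc⟩


/-! ## §4 The three coupling windows follow from `γ` small; the window-free chart line -/

/-- The coupling threshold below which `θBal(b₀,p₀)(i) ≤ σ` at EVERY height `i` and every `L ≥ 1` (`T3Thresholds.θBal_le_of_le_gamma`). [cite: Balaban1985UV3, (7) p.257, p.267] -/
def gammaθ (b₀ p₀ σ : ℝ) : ℝ := ((σ / (b₀ * ((2 * p₀) ^ p₀ * Real.exp (1 / 2 - p₀)))) ^ 2) ^ 2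

/-- `0 < gammaθ b₀ p₀ σ` for `b₀, p₀, σ > 0`. [folklore] -/
theorem gammaθ_pos {b₀ p₀ σ : ℝ} (hb : 0 < b₀) (hp : 0 < p₀) (hσ : 0 < σ) : 0 < gammaθ b₀ p₀ σ := by
  unfold gammaθ
  have h2 : 0 < (2 * p₀) ^ p₀ := Real.rpow_pos_of_pos (by linarith) _
  positivity

/-- **WINDOW `(C_s + C_B)·θ(n) ≤ 1`** from `γ ≤ gammaθ b₀ p₀ (1 / max 1 (C_s + C_B))` (explicit-threshold form; the existential form is ym3-torus-p2 g14's
`GlobalSlackChartsToGlobal.exists_gamma_window`, p532981). [cite: Balaban1985UV3, (7) p.257, p.267] -/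
theorem window_sum_le_one {L : ℕ} (hL : 1 ≤ L) {γ b₀ p₀ C_s C_B : ℝ} (hb : 0 < b₀) (hp : 0 < p₀)
    (hγ : 0 < γ) (hγ1 : γ ≤ 1) (hγw : γ ≤ gammaθ b₀ p₀ (1 / max 1 (C_s + C_B))) (n : ℕ) :
    (C_s + C_B) * θBal L γ b₀ p₀ n ≤ 1 := by
  have hm0 : 0 < max 1 (C_s + C_B) := lt_of_lt_of_le one_pos (le_max_left _ _)
  have hθ := T3Thresholds.θBal_le_of_le_gamma hL hb hp (σ := 1 / max 1 (C_s + C_B)) (by positivity) hγ hγ1 hγw n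
  have hθ0 : 0 ≤ θBal L γ b₀ p₀ n := (T3MinimiserStabilityReduction.θBal_pos hL hγ hγ1 hb p₀ n).le
  calc (C_s + C_B) * θBal L γ b₀ p₀ n ≤ max 1 (C_s + C_B) * (1 / max 1 (C_s + C_B)) := mul_le_mul (le_max_right _ _) hθ hθ0 hm0.le
    _ = 1 := by field_simp

/-- `r(g)·g·p_{p₀}(g) = g·p_{p₀+r₀}(g)` for `0 < g ≤ 1` (the collar polylogarithm joins the threshold's). [cite: Balaban1985UV3, (7) p.257] -/
theorem rFun_mul_mul_pFun {r₀ b₀ p₀ g : ℝ} (hg : 0 < g) (hg1 : g ≤ 1) :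
    B10.rFun r₀ g * g * B10.pFun b₀ p₀ g = g * B10.pFun b₀ (p₀ + r₀) g := by
  have hx : 0 < 1 + Real.log g⁻¹ := by
    have : 0 ≤ Real.log g⁻¹ := Real.log_nonneg ((one_le_inv₀ hg).mpr hg1)
    linarith
  unfold B10.rFun B10.pFun
  rw [Real.rpow_add hx]
  ring

variable {F : T3Family} {𝔠 : AlphaConsts F.L (suGroupModel 2).N} {γ : ℝ} {hγ : 0 < γ} {hγ1 : γ ≤ (min 𝔠.gamma0 1) ^ 2}

/-- **THE JET WINDOW `cB·r(g_k)g_kp(g_k) ≤ ρ/4`** along the steps `k + 1 ≤ K` of every run, from `γ ≤ gammaθ b₀ (p₀ + r₀) (ρ / (4·max 1 cB))`. [cite: Balaban1985UV3, (7) p.257, (28) p.263] -/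
theorem window_jet (hγw : γ ≤ gammaθ 𝔠.b₀ (𝔠.p₀ + 𝔠.r₀) (𝔠.ρ / (4 * max 1 𝔠.cB))) (K k : ℕ) (hk : k + 1 ≤ K) :
    𝔠.cB * (B10.rFun 𝔠.r₀ ((SK F 𝔠 γ hγ hγ1 K).gk k) * (SK F 𝔠 γ hγ hγ1 K).gk k * B10.pFun 𝔠.b₀ 𝔠.p₀ ((SK F 𝔠 γ hγ hγ1 K).gk k)) ≤ 𝔠.ρ / 4 := by
  have hL : 1 ≤ F.L := F.hL.2.le
  have hL0 : (0 : ℝ) < F.L := by exact_mod_cast (zero_lt_one.trans F.hL.2)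
  have hγ1' : γ ≤ 1 := hγ1.trans (sq_min_one_le _ 𝔠.gamma0_pos)
  have hg : (SK F 𝔠 γ hγ hγ1 K).gk k = Real.sqrt (γ * ((F.L : ℝ)⁻¹) ^ (K - k)) := by rw [SK, T3Scales_gk_eq F γ hγ _ K k (by omega)]
  have hg0 : 0 < Real.sqrt (γ * ((F.L : ℝ)⁻¹) ^ (K - k)) := Real.sqrt_pos.2 (mul_pos hγ (pow_pos (inv_pos.2 hL0) _))
  have hg1 : Real.sqrt (γ * ((F.L : ℝ)⁻¹) ^ (K - k)) ≤ 1 := T3Thresholds.coupling_le_one hL hγ hγ1' (K - k)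
  rw [hg, rFun_mul_mul_pFun hg0 hg1, ← T3Thresholds.θBal_eq F.L γ 𝔠.b₀ (𝔠.p₀ + 𝔠.r₀) (K - k)]
  have hp' : 0 < 𝔠.p₀ + 𝔠.r₀ := by linarith [𝔠.p₀_pos, 𝔠.one_le_r₀]
  have hρ := 𝔠.ρ_pos
  have hm0 : 0 < max 1 𝔠.cB := lt_of_lt_of_le one_pos (le_max_left _ _)
  have hθ := T3Thresholds.θBal_le_of_le_gamma hL 𝔠.b₀_pos hp' (σ := 𝔠.ρ / (4 * max 1 𝔠.cB)) (by positivity) hγ hγ1' hγw (K - k)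
  have hθ0 : 0 ≤ θBal F.L γ 𝔠.b₀ (𝔠.p₀ + 𝔠.r₀) (K - k) := (T3MinimiserStabilityReduction.θBal_pos hL hγ hγ1' 𝔠.b₀_pos _ _).le
  calc 𝔠.cB * θBal F.L γ 𝔠.b₀ (𝔠.p₀ + 𝔠.r₀) (K - k) ≤ max 1 𝔠.cB * (𝔠.ρ / (4 * max 1 𝔠.cB)) := mul_le_mul (le_max_right _ _) hθ hθ0 hm0.le
    _ = 𝔠.ρ / 4 := by field_simp

/-- **THE OLD-SLICE WINDOW `8L²B₃Z′·g_kp(g_k) ≤ ½`** along the steps `k + 1 ≤ K` of every run, from `γ ≤ gammaθ b₀ p₀ (1 / (2·8(L+1)²B₃Z′))`. [cite: Balaban1985UV3, (7) p.257, (44)-(46) p.267] -/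
theorem window_oldSlice (hγw : γ ≤ gammaθ 𝔠.b₀ 𝔠.p₀ (1 / (2 * (8 * ((F.L : ℝ) + 1) ^ 2 * 𝔠.B₃ * 𝔠.Zfull)))) (K k : ℕ) (hk : k + 1 ≤ K) :
    8 * (F.L : ℝ) ^ 2 * 𝔠.B₃ * 𝔠.Zfull * ((SK F 𝔠 γ hγ hγ1 K).gk k * B10.pFun 𝔠.b₀ 𝔠.p₀ ((SK F 𝔠 γ hγ hγ1 K).gk k)) ≤ 1 / 2 := by
  have hL : 1 ≤ F.L := F.hL.2.le
  have hγ1' : γ ≤ 1 := hγ1.trans (sq_min_one_le _ 𝔠.gamma0_pos)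
  have hB := 𝔠.B₃_pos; have hZ := 𝔠.Zfull_pos
  have hA : 0 ≤ 8 * (F.L : ℝ) ^ 2 * 𝔠.B₃ * 𝔠.Zfull := by positivity
  have hA' : 0 < 8 * ((F.L : ℝ) + 1) ^ 2 * 𝔠.B₃ * 𝔠.Zfull := by positivity
  have hAA' : 8 * (F.L : ℝ) ^ 2 * 𝔠.B₃ * 𝔠.Zfull ≤ 8 * ((F.L : ℝ) + 1) ^ 2 * 𝔠.B₃ * 𝔠.Zfull := by
    have h1 : (F.L : ℝ) ^ 2 ≤ ((F.L : ℝ) + 1) ^ 2 := by nlinarith [Nat.cast_nonneg (α := ℝ) F.L]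
    have h2 : 0 ≤ 𝔠.B₃ * 𝔠.Zfull := by positivity
    nlinarith
  have heq : (SK F 𝔠 γ hγ hγ1 K).gk k * B10.pFun 𝔠.b₀ 𝔠.p₀ ((SK F 𝔠 γ hγ hγ1 K).gk k) = θBal F.L γ 𝔠.b₀ 𝔠.p₀ (K - k) := by
    rw [SK, T3Scales_gk_eq F γ hγ _ K k (by omega)]; rfl
  rw [heq]
  have hθ := T3Thresholds.θBal_le_of_le_gamma hL 𝔠.b₀_pos 𝔠.p₀_pos (σ := 1 / (2 * (8 * ((F.L : ℝ) + 1) ^ 2 * 𝔠.B₃ * 𝔠.Zfull)))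
    (by positivity) hγ hγ1' hγw (K - k)
  calc 8 * (F.L : ℝ) ^ 2 * 𝔠.B₃ * 𝔠.Zfull * θBal F.L γ 𝔠.b₀ 𝔠.p₀ (K - k)
      ≤ 8 * (F.L : ℝ) ^ 2 * 𝔠.B₃ * 𝔠.Zfull * (1 / (2 * (8 * ((F.L : ℝ) + 1) ^ 2 * 𝔠.B₃ * 𝔠.Zfull))) := mul_le_mul_of_nonneg_left hθ hA
    _ = 8 * (F.L : ℝ) ^ 2 * 𝔠.B₃ * 𝔠.Zfull / (2 * (8 * ((F.L : ℝ) + 1) ^ 2 * 𝔠.B₃ * 𝔠.Zfull)) := by ring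
    _ ≤ 8 * ((F.L : ℝ) + 1) ^ 2 * 𝔠.B₃ * 𝔠.Zfull / (2 * (8 * ((F.L : ℝ) + 1) ^ 2 * 𝔠.B₃ * 𝔠.Zfull)) := by gcongr
    _ = 1 / 2 := by field_simp

/-- The joint coupling threshold of the three windows (as a function of `L`, the record and the configuration constants). [cite: Balaban1985UV3, (7) p.257, p.267] -/
def gammaW (L : ℕ) (𝔠 : AlphaConsts L (suGroupModel 2).N) (C_s C_B : ℝ) : ℝ :=
  min (gammaθ 𝔠.b₀ 𝔠.p₀ (1 / max 1 (C_s + C_B)))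
    (min (gammaθ 𝔠.b₀ (𝔠.p₀ + 𝔠.r₀) (𝔠.ρ / (4 * max 1 𝔠.cB))) (gammaθ 𝔠.b₀ 𝔠.p₀ (1 / (2 * (8 * ((L : ℝ) + 1) ^ 2 * 𝔠.B₃ * 𝔠.Zfull)))))

/-- `0 < gammaW`. [folklore] -/
theorem gammaW_pos (L : ℕ) (𝔠 : AlphaConsts L (suGroupModel 2).N) (C_s C_B : ℝ) : 0 < gammaW L 𝔠 C_s C_B := by
  have hb := 𝔠.b₀_pos; have hp := 𝔠.p₀_pos; have hρ := 𝔠.ρ_pos; have hB := 𝔠.B₃_pos; have hZ := 𝔠.Zfull_pos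
  have hp' : 0 < 𝔠.p₀ + 𝔠.r₀ := by linarith [𝔠.one_le_r₀]
  have hm0 : 0 < max 1 (C_s + C_B) := lt_of_lt_of_le one_pos (le_max_left _ _)
  have hm1 : 0 < max 1 𝔠.cB := lt_of_lt_of_le one_pos (le_max_left _ _)
  exact lt_min (gammaθ_pos hb hp (by positivity)) (lt_min (gammaθ_pos hb hp' (by positivity)) (gammaθ_pos hb hp (by positivity)))

/-- **THE K1a CHART ROWS AT THE CANONICAL POLYMERISATION, WINDOW-FREE** — `K1aChartLine` without the three coupling windows (they follow from `γ ≤ gammaW`): the located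
letters `0 < κ ≤ 𝔠.κ`, `κ₀(32,6) ≤ κ`, `L ≤ M₁`, nonnegative constants, a threshold, and for every family / coupling / inhabited v3 package a coherent family `p` with
the given [7]-constants and ONE chart family with the SIX CHART ROWS at `dataOfV3 p (canonPolymer p)` / `canonPT p`.  Hypothesis schema; never asserted.
[cite: Balaban1985UV3, (25) p.262, (28)-(30) p.263, (33)-(34) p.264, (43)-(46) pp.266-267; King1986, Thm 3.4 (3.9) p.656, Prop. 3.6 (3.56) p.662] -/
def K1aChartRows (L : ℕ) (𝔠 : AlphaConsts L (suGroupModel 2).N) (a₀ a₁ a : ℝ) : Prop :=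
  ∃ (κ C C_E C_R C_s C_B γB : ℝ), 0 < κ ∧ κ ≤ 𝔠.κ ∧ kappa₀ (4 * 2 ^ 3) (2 * 3) ≤ κ ∧ 0 ≤ C ∧ 0 ≤ C_E ∧ 0 ≤ C_R ∧ 0 ≤ C_s ∧ 0 ≤ C_B ∧ 0 < γB ∧
    L ≤ 𝔠.M₁ ∧
    ∀ (F : T3Family) (γ : ℝ) (hF : F.L = L) (hγ : 0 < γ), γ ≤ γB → ∀ (hγ1 : γ ≤ (min (hF ▸ 𝔠).gamma0 1) ^ 2),
      AlphaInputsT3AC.OfV3At F (hF ▸ 𝔠) a₀ a₁ →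
        ∃ (p : ∀ K, AlphaInputsT3AC.PkgAtV3 F (hF ▸ 𝔠) γ hγ hγ1 K), (∀ K, (p K).a₀ = a₀ ∧ (p K).a₁ = a₁) ∧
          ∃ (Φ : ChartFam ↥(lieC (suGroupModel 2)) F) (e : VacFam F) (B : CfgFam ↥(lieC (suGroupModel 2)) F) (R : RemFam F),
            TaylorSplitΦ (canonPT p) Φ e B R ∧ FlatKernelCauchyΦ (AlphaInputsT3AC.dataOfV3 p (canonPolymer p)) Φ κ a C ∧
            KernelSizeΦ (AlphaInputsT3AC.dataOfV3 p (canonPolymer p)) Φ κ C_E ∧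
            RemainderSmallΦ (AlphaInputsT3AC.dataOfV3 p (canonPolymer p)) R (hF ▸ 𝔠).b₀ (hF ▸ 𝔠).p₀ κ C_R ∧
            CfgSizeΦ (AlphaInputsT3AC.dataOfV3 p (canonPolymer p)) B (hF ▸ 𝔠).b₀ (hF ▸ 𝔠).p₀ C_s ∧
            CfgCauchyΦ (AlphaInputsT3AC.dataOfV3 p (canonPolymer p)) B (hF ▸ 𝔠).b₀ (hF ▸ 𝔠).p₀ a C_B fun _ => 1

/-- **THE WINDOW-FREE ROWS GIVE THE CHART LINE** (threshold `γB ⊓ gammaW L 𝔠 C_s C_B`; the three windows by `window_sum_le_one`, `window_jet`, `window_oldSlice`).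
[cite: Balaban1985UV3, (7) p.257, p.267] -/
theorem k1aChartLine_of_chartRows {L : ℕ} {𝔠 : AlphaConsts L (suGroupModel 2).N} {a₀ a₁ a : ℝ} (h : K1aChartRows L 𝔠 a₀ a₁ a) : K1aChartLine L 𝔠 a₀ a₁ a := by
  obtain ⟨κ, C, C_E, C_R, C_s, C_B, γB, hκ0, hκle, hκ₀, hC, hCE, hCR, hCs, hCB, hγB, hM, hall⟩ := h
  refine ⟨κ, C, C_E, C_R, C_s, C_B, min γB (gammaW L 𝔠 C_s C_B), hκ0, hκle, hκ₀, hC, hCE, hCR, hCs, hCB, lt_min hγB (gammaW_pos L 𝔠 C_s C_B), hM,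
    fun F γ hF hγ hγle hγ1 hOf => ?_⟩
  subst hF
  have hγB' : γ ≤ γB := hγle.trans (min_le_left _ _)
  have hW : γ ≤ gammaW F.L 𝔠 C_s C_B := hγle.trans (min_le_right _ _)
  have h0 : γ ≤ gammaθ 𝔠.b₀ 𝔠.p₀ (1 / max 1 (C_s + C_B)) := hW.trans (min_le_left _ _)
  have h1 : γ ≤ gammaθ 𝔠.b₀ (𝔠.p₀ + 𝔠.r₀) (𝔠.ρ / (4 * max 1 𝔠.cB)) := hW.trans ((min_le_right _ _).trans (min_le_left _ _))
  have h2 : γ ≤ gammaθ 𝔠.b₀ 𝔠.p₀ (1 / (2 * (8 * ((F.L : ℝ) + 1) ^ 2 * 𝔠.B₃ * 𝔠.Zfull))) := hW.trans ((min_le_right _ _).trans (min_le_right _ _))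
  have hγ1' : γ ≤ 1 := hγ1.trans (sq_min_one_le _ 𝔠.gamma0_pos)
  obtain ⟨p, hp, Φ, e, B, R, hT, hK, hE, hR, hS, hBC⟩ := hall F γ rfl hγ hγB' hγ1 hOf
  exact ⟨fun n => window_sum_le_one F.hL.2.le 𝔠.b₀_pos 𝔠.p₀_pos hγ hγ1' h0 n,
    fun K k hk => window_jet (hγ := hγ) (hγ1 := hγ1) h1 K k hk, fun K k hk => window_oldSlice (hγ := hγ) (hγ1 := hγ1) h2 K k hk,
    p, hp, Φ, e, B, R, hT, hK, hE, hR, hS, hBC⟩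

/-- **THE REGISTERED STUB 3⁗ FROM THE SIX CHART ROWS ALONE (WINDOW-FREE FORM), BY NAME** (`globalTwoRunSlackFam_of_k1aChartLine ∘ k1aChartLine_of_chartRows`).
[cite: King1986, Thm 3.4 (3.9) p.656, Prop. 3.6 p.662; Balaban1985UV3, (7) p.257, (43)-(46) pp.266-267, (57) p.270] -/
theorem globalTwoRunSlackFam_of_k1aChartRows
    (h : ∀ (L : ℕ), Odd L → 7 ≤ L → ∀ (𝔠 : AlphaConsts L (suGroupModel 2).N) (a₀ a₁ : ℝ), 0 < a₀ → 0 < a₁ → 𝔠.B₃ * a₁ ≤ a₀ →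
      ∃ a : ℝ, 0 < a ∧ a < 1 ∧ K1aChartRows L 𝔠 a₀ a₁ a) :
    ∀ (L : ℕ), Odd L → 7 ≤ L → ∀ (𝔠 : Summit.QuantumFields.Balaban3D.Proofs.Primitives.AlphaConsts L (Summit.QuantumFields.Balaban3D.Carriers.suGroupModel 2).N)
      (a₀ a₁ : ℝ), 0 < a₀ → 0 < a₁ → 𝔠.B₃ * a₁ ≤ a₀ →
      ∃ a : ℝ, 0 < a ∧ ∃ γB : ℝ, 0 < γB ∧ ∀ (F : T3Family) (γ : ℝ) (hF : F.L = L) (hγ : 0 < γ), γ ≤ γB →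
        ∀ (hγ1 : γ ≤ (min (hF ▸ 𝔠).gamma0 1) ^ 2),
          Summit.QuantumFields.YangMills.Theorems.AlphaInputsT3AC.OfV3At F (hF ▸ 𝔠) a₀ a₁ →
          ∃ (p : ∀ K, Summit.QuantumFields.YangMills.Theorems.AlphaInputsT3AC.PkgAtV3 F (hF ▸ 𝔠) γ hγ hγ1 K),
            (∀ K, (p K).a₀ = a₀ ∧ (p K).a₁ = a₁) ∧
            ∃ (π : Summit.QuantumFields.YangMills.Theorems.AlphaInputsT3AC.PolymerT3 F) (σ : ℕ) (C : ℝ), 7 ≤ σ ∧ 0 ≤ C ∧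
              Summit.QuantumFields.YangMills.Theorems.GlobalSlack.GlobalSupRateTSlack (Summit.QuantumFields.YangMills.Theorems.AlphaInputsT3AC.dataOfV3 p π) (hF ▸ 𝔠).b₀ (hF ▸ 𝔠).p₀ a σ C :=
  globalTwoRunSlackFam_of_k1aChartLine fun L hLo h7 𝔠 a₀ a₁ ha0 ha1 hw => by
    obtain ⟨a, ha, ha1', hc⟩ := h L hLo h7 𝔠 a₀ a₁ ha0 ha1 hw
    exact ⟨a, ha, ha1', k1aChartLine_of_chartRows hc⟩

end Summit.QuantumFields.YangMills.Theorems.GlobalSlackCanonicalPolymers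

end
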